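import Summits.AtomisticToContinuum.Crystallization.Theorems.FrustratedLawDichotomyStrainedPatchHomCurvCoeff

/-!
# Per-label curvature coefficients in the kernel, WINDOW regime `3 < ρ < 9/2` (sequel of `…HomCurvCoeff`)

decomp-a2c hand-1 g26 (crux `AperiodicFrustratedLawGap`, stmt-AtomisticToContinuum-27623; `λ`-leaf of lever (C)).  In the window regime
(`…HomCurvRegime.beta_window / alpha_window`): `β = (q⁻⁴ − q⁻⁷)·c(ρ) + V(q)·c′(ρ)·ρ·q⁻¹`, `α = (14q⁻⁸ − 8q⁻⁵)·c(ρ) + (2ρ(q⁻⁴ − q⁻⁷)c′(ρ) −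
V(q)c′(ρ)ρq⁻¹ + V(q)c″(ρ))·q⁻¹` with `V(q) = q⁻⁶/12 − q⁻³/6`, `c = (16ρ³ − 180ρ² + 648ρ − 729)/27`, `c′ = (16ρ² − 120ρ + 216)/9`, `c″ = (32ρ − 120)/9`,
`ρ = √q` (two-sided `FI.sqrt`).  FI-valued kernel definitions `cWinFI`, `c1WinFI`, `c2WinFI`, `vljFI`, ★ `betaWinFI`, ★ `alphaWinFI` with `FI.mem`
soundness against exactly these real expressions.  0 sorry; standard axioms; no instances / notation / `#eval`.  `--supports stmt-AtomisticToContinuum-27623`.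
-/

noncomputable section

namespace Summit.AtomisticToContinuum.Crystallization.Theorems.FrustratedLawDichotomyStrainedPatchHomCurvCoeff

open Literature.Analysis.ValidatedNumerics.Numerics
open Summit.AtomisticToContinuum.Crystallization.Theorems.FrustratedLawDichotomyStrainedPatchHomForceKit (phiFI mem_phiFI)

/-! ## §4. Window regime -/

/-- `c(ρ) = (16ρ³ − 180ρ² + 648ρ − 729)/27` (`= 1 − w₄₅` on the window), Horner. -/
def cWinFI (R : FI) : FI :=
  ((((((R.mulInt 16).add (FI.ofInt (-180))).mul R).add (FI.ofInt 648)).mul R).add (FI.ofInt (-729))).divNat 27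

/-- [folklore] -/
theorem mem_cWinFI {ρ : ℝ} {R : FI} (h : FI.mem ρ R) : FI.mem ((16 * ρ ^ 3 - 180 * ρ ^ 2 + 648 * ρ - 729) / 27) (cWinFI R) := by
  have h1 := FI.mem_add (FI.mem_mulInt h 16) (FI.mem_ofInt (-180))
  have h2 := FI.mem_add (FI.mem_mul h1 h) (FI.mem_ofInt 648)
  have h3 := FI.mem_add (FI.mem_mul h2 h) (FI.mem_ofInt (-729))
  have h4 := FI.mem_divNat h3 (n := 27) (by norm_num)
  push_cast at h4
  convert h4 using 1 <;> first | rfl | ring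

/-- `c′(ρ) = (16ρ² − 120ρ + 216)/9`, Horner. -/
def c1WinFI (R : FI) : FI := ((((R.mulInt 16).add (FI.ofInt (-120))).mul R).add (FI.ofInt 216)).divNat 9

/-- [folklore] -/
theorem mem_c1WinFI {ρ : ℝ} {R : FI} (h : FI.mem ρ R) : FI.mem ((16 * ρ ^ 2 - 120 * ρ + 216) / 9) (c1WinFI R) := by
  have h1 := FI.mem_add (FI.mem_mulInt h 16) (FI.mem_ofInt (-120))
  have h2 := FI.mem_add (FI.mem_mul h1 h) (FI.mem_ofInt 216)
  have h3 := FI.mem_divNat h2 (n := 9) (by norm_num)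
  push_cast at h3
  convert h3 using 1 <;> first | rfl | ring

/-- `c″(ρ) = (32ρ − 120)/9`. -/
def c2WinFI (R : FI) : FI := ((R.mulInt 32).add (FI.ofInt (-120))).divNat 9

/-- [folklore] -/
theorem mem_c2WinFI {ρ : ℝ} {R : FI} (h : FI.mem ρ R) : FI.mem ((32 * ρ - 120) / 9) (c2WinFI R) := by
  have h1 := FI.mem_add (FI.mem_mulInt h 32) (FI.mem_ofInt (-120))
  have h2 := FI.mem_divNat h1 (n := 9) (by norm_num)
  push_cast at h2
  convert h2 using 1 <;> first | rfl | ring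

/-- `V(q) = u⁶/12 − u³/6` from `u ∋ q⁻¹`. -/
def vljFI (u : FI) : FI :=
  let u3 := (u.mul u).mul u
  ((u3.mul u3).divNat 12).sub (u3.divNat 6)

/-- [folklore] -/
theorem mem_vljFI {x : ℝ} {u : FI} (h : FI.mem x u) : FI.mem (1 / 12 * x ^ 6 - 1 / 6 * x ^ 3) (vljFI u) := by
  have h3 : FI.mem (x ^ 3) ((u.mul u).mul u) := by
    rw [show x ^ 3 = x * x * x by ring]; exact FI.mem_mul (FI.mem_mul h h) h
  have h6 : FI.mem (x ^ 6) (((u.mul u).mul u).mul ((u.mul u).mul u)) := by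
    rw [show x ^ 6 = x ^ 3 * x ^ 3 by ring]; exact FI.mem_mul h3 h3
  have key := FI.mem_sub (FI.mem_divNat h6 (n := 12) (by norm_num)) (FI.mem_divNat h3 (n := 6) (by norm_num))
  push_cast at key
  convert key using 1 <;> first | rfl | ring

/-- ★ `β` in the window regime (`none` iff `Q` reaches `0`). -/
def betaWinFI (Q : FI) : Option FI :=
  match phiFI Q, FI.divPos (FI.ofInt 1) Q with
  | some P, some u =>
    let R := FI.sqrt Q
    some ((P.mul (cWinFI R)).add ((((vljFI u).mul (c1WinFI R)).mul R).mul u))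
  | _, _ => none

/-- ★ Soundness of `betaWinFI` (`ρ ≥ 0`, `q = ρ²`). [folklore] -/
theorem mem_betaWinFI {ρ : ℝ} (hρ : 0 ≤ ρ) {Q B : FI} (hq : FI.mem (ρ ^ 2) Q) (h : betaWinFI Q = some B) :
    FI.mem ((((ρ ^ 2)⁻¹) ^ 4 - ((ρ ^ 2)⁻¹) ^ 7) * ((16 * ρ ^ 3 - 180 * ρ ^ 2 + 648 * ρ - 729) / 27) +
      (1 / 12 * ((ρ ^ 2)⁻¹) ^ 6 - 1 / 6 * ((ρ ^ 2)⁻¹) ^ 3) * ((16 * ρ ^ 2 - 120 * ρ + 216) / 9) * ρ * (ρ ^ 2)⁻¹) B := by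
  unfold betaWinFI at h
  cases hP : phiFI Q with
  | none => rw [hP] at h; exact absurd h (by simp)
  | some P =>
    cases hu : FI.divPos (FI.ofInt 1) Q with
    | none => rw [hP, hu] at h; exact absurd h (by simp)
    | some u =>
      rw [hP, hu] at h
      simp only [Option.some.injEq] at h
      subst h
      have hPm := mem_phiFI hq hP
      have huu : FI.mem ((ρ ^ 2)⁻¹) u := by
        have := FI.mem_divPos hu (by simpa using FI.mem_ofInt 1) hq
        simpa [one_div] using this
      have hR : FI.mem ρ (FI.sqrt Q) := by
        have := FI.mem_sqrt hq
        rwa [Real.sqrt_sq hρ] at this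
      exact FI.mem_add (FI.mem_mul hPm (mem_cWinFI hR))
        (FI.mem_mul (FI.mem_mul (FI.mem_mul (mem_vljFI huu) (mem_c1WinFI hR)) hR) huu)

/-- ★ `α` in the window regime (`none` iff `Q` reaches `0`). -/
def alphaWinFI (Q : FI) : Option FI :=
  match phiFI Q, alphaLJFI Q, FI.divPos (FI.ofInt 1) Q with
  | some P, some A, some u =>
    let R := FI.sqrt Q
    let V := vljFI u
    let c1 := c1WinFI R
    some ((A.mul (cWinFI R)).add
      ((((((R.mulInt 2).mul P).mul c1).sub (((V.mul c1).mul R).mul u)).add (V.mul (c2WinFI R))).mul u))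
  | _, _, _ => none

/-- ★ Soundness of `alphaWinFI`. [folklore] -/
theorem mem_alphaWinFI {ρ : ℝ} (hρ : 0 ≤ ρ) {Q A : FI} (hq : FI.mem (ρ ^ 2) Q) (h : alphaWinFI Q = some A) :
    FI.mem ((14 * ((ρ ^ 2)⁻¹) ^ 8 - 8 * ((ρ ^ 2)⁻¹) ^ 5) * ((16 * ρ ^ 3 - 180 * ρ ^ 2 + 648 * ρ - 729) / 27) +
      (2 * ρ * (((ρ ^ 2)⁻¹) ^ 4 - ((ρ ^ 2)⁻¹) ^ 7) * ((16 * ρ ^ 2 - 120 * ρ + 216) / 9) -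
        (1 / 12 * ((ρ ^ 2)⁻¹) ^ 6 - 1 / 6 * ((ρ ^ 2)⁻¹) ^ 3) * ((16 * ρ ^ 2 - 120 * ρ + 216) / 9) * ρ * (ρ ^ 2)⁻¹ +
        (1 / 12 * ((ρ ^ 2)⁻¹) ^ 6 - 1 / 6 * ((ρ ^ 2)⁻¹) ^ 3) * ((32 * ρ - 120) / 9)) * (ρ ^ 2)⁻¹) A := by
  unfold alphaWinFI at h
  cases hP : phiFI Q with
  | none => rw [hP] at h; exact absurd h (by simp)
  | some P =>
    cases hA : alphaLJFI Q with
    | none => rw [hP, hA] at h; exact absurd h (by simp)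
    | some A0 =>
      cases hu : FI.divPos (FI.ofInt 1) Q with
      | none => rw [hP, hA, hu] at h; exact absurd h (by simp)
      | some u =>
        rw [hP, hA, hu] at h
        simp only [Option.some.injEq] at h
        subst h
        have hPm := mem_phiFI hq hP
        have hAm := mem_alphaLJFI hq hA
        have huu : FI.mem ((ρ ^ 2)⁻¹) u := by
          have := FI.mem_divPos hu (by simpa using FI.mem_ofInt 1) hq
          simpa [one_div] using this
        have hR : FI.mem ρ (FI.sqrt Q) := by
          have := FI.mem_sqrt hq
          rwa [Real.sqrt_sq hρ] at this
        have hV := mem_vljFI huu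
        have hc := mem_cWinFI hR
        have hc1 := mem_c1WinFI hR
        have hc2 := mem_c2WinFI hR
        have h2ρ : FI.mem (ρ * (2 : ℤ)) ((FI.sqrt Q).mulInt 2) := FI.mem_mulInt hR 2
        have key := FI.mem_add (FI.mem_mul hAm hc)
          (FI.mem_mul (FI.mem_add (FI.mem_sub (FI.mem_mul (FI.mem_mul h2ρ hPm) hc1) (FI.mem_mul (FI.mem_mul (FI.mem_mul hV hc1) hR) huu))
            (FI.mem_mul hV hc2)) huu)
        push_cast at key
        convert key using 2
        ring

end Summit.AtomisticToContinuum.Crystallization.Theorems.FrustratedLawDichotomyStrainedPatchHomCurvCoeff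

end
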